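import Summits.SmoothPoincare4.SmoothPoincare4.Theorems.ConvexBisectionAcyclicBisectionRigidityStubSteinHandleNormalForm
import Summits.SmoothPoincare4.SmoothPoincare4.Theorems.ConvexBisectionAcyclicBisectionRigidityStubFactGompf
import Summits.SmoothPoincare4.SmoothPoincare4.Theorems.ConvexBisectionAcyclicBisectionRigiditySeamGluingTransport
import Summits.SmoothPoincare4.SmoothPoincare4.Theorems.AcyclicBisectionRigidity.Negative.LoadBearing
import Literature.Topology.FourManifolds.SphereFourOneZeroOneSplitting
import HarnessLib

/-!
# Certificates for the levers of line `seam-duality-cancellation` (crux `ConvexBisection.AcyclicBisectionRigidity`,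
# item stmt-SmoothPoincare4-10507, route route-SmoothPoincare4-ConvexBisection; lead c2, reshape s6)

The merged carrier skeleton of the crux (`Cruxes/AcyclicBisectionRigidity/Lines/seam_duality_cancellation.lean`,
reshape s6) proves the crux BY NAME from two conjectural LEVERS — the Mazur–Mazur seam-pair dichotomy
`stub_seamPairDichotomy` (lever A) and the GSC lever `stub_gscOfNonDouble` (crux data + non-double ⇒ a Morse
function on `M` without index-1 critical points) — plus two item-shaped residuals (items 0377, 3546/3717) and four
named-fact debts.  This helper file lands the sorry-free CERTIFICATES that position the two levers formally:

* `gscOfNonDouble_of_crossCancellation` — the sibling line's lever B (`ExchangeRecognition.stub_crossCancellation`,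
  VERBATIM, as the hypothesis `hL`; handed back `promote-stub` by lead a1-0) implies the GSC lever: feed it the landed
  balanced Stein normal form of `W₂` (`ExchangeRecognition.stub_steinHandleNormalForm`, Gompf 1998 Thm 1.3 (a)
  discharged in the tree) and forget the 2-handle count.  So the GSC lever is at most as strong as lever B, and a
  proof of lever B closes it by `exact`.
* `gscOfNonDouble_of_crux`, `gscOfNonDouble_of_spc4` — the GSC lever is implied by the crux (pull back the tree's
  Morse function on the round sphere with profile `(1,0,1,1,1)`, `exists_isMorse_sphereFour_twoThree`, along
  `M ≅ S⁴` by `SeamGluing.IsMorse.comp_diffeomorph`), hence by `SmoothPoincare4`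
  (`Negative.not_smoothPoincare4_of_not_crux`): refutable only by an exotic 4-sphere.
* `seamPairDichotomy_of_crux`, `seamPairDichotomy_of_spc4` — the same for lever A (its first horn is the pulled-back
  profile `(1,0,1,1,1)` on the nose, `SeamGluing.ncard_criticalSetOfIndex_comp_diffeomorph`).

For lever B verbatim (prescribed 2-handle count `n₂`) the analogous certificate would need births of `n₂`
cancelling `2/3` pairs on `S⁴`, which the tree does not have; this asymmetry is one of the reasons the lead
recommends promoting the GSC lever rather than lever B (evidence `PROMOTE-gsc-lever.md` on the item).
Everything here is proved; no definitions, no named facts. [folklore]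
-/

noncomputable section

-- The namespace is prescribed by the crux protocol (`Summit.<P>.<Sub>.Theorems.<Crux>.<Line>`
-- with `P = Sub = SmoothPoincare4`), hence the duplicated component.
set_option linter.dupNamespace false

open scoped Manifold ContDiff Topology ContinuousMap
open Set Function
open Literature.Geometry.Symplectic Literature.AlgebraicTopology.SingularHomology CategoryTheory.Limits
open Literature.Topology.FourManifolds

namespace Summit.SmoothPoincare4.SmoothPoincare4.Theorems.AcyclicBisectionRigidity.SeamDualityCancellation

open Summit.SmoothPoincare4.SmoothPoincare4.Theses
open Summit.SmoothPoincare4.SmoothPoincare4.Theorems.AcyclicBisectionRigidity.ExchangeRecognition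
  (stub_steinHandleNormalForm stub_factGompf)
open Summit.SmoothPoincare4.SmoothPoincare4.Theorems.AcyclicBisectionRigidity.SeamGluing
  (IsMorse.comp_diffeomorph criticalSetOfIndex_comp_diffeomorph ncard_criticalSetOfIndex_comp_diffeomorph)

/-- **Lever B (VERBATIM the sibling's `ExchangeRecognition.stub_crossCancellation`, as the hypothesis `hL`) implies the GSC lever**:
feed it the landed balanced Stein normal form of `W₂` (`stub_steinHandleNormalForm` with the crux data swapped, `stub_factGompf`) and
forget the 2-handle count. So a proof of the statement lead a1-0 handed back `promote-stub` closes `stub_gscOfNonDouble` by `exact`, and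
the GSC lever is at most as strong as lever B. [folklore] -/
theorem gscOfNonDouble_of_crossCancellation
    (hL : ∀ (M : Type) [TopologicalSpace M] [T2Space M] [SecondCountableTopology M] [ChartedSpace (EuclideanSpace ℝ (Fin 4)) M]
      [IsManifold (𝓡 4) ∞ M] (_hM : M ≃ₕ Metric.sphere (0 : EuclideanSpace ℝ (Fin 5)) 1)
      (W₁ : Type) [TopologicalSpace W₁] [ChartedSpace (EuclideanHalfSpace 4) W₁] [IsManifold (𝓡∂ 4) ∞ W₁]
      [CompactSpace W₁] (W₂ : Type) [TopologicalSpace W₂] [ChartedSpace (EuclideanHalfSpace 4) W₂]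
      [IsManifold (𝓡∂ 4) ∞ W₂] [CompactSpace W₂] (J₁ : SteinStructure W₁) (J₂ : SteinStructure W₂)
      (e₁ : W₁ → M) (e₂ : W₂ → M)
      (_he₁ : Manifold.IsSmoothEmbedding (𝓡∂ 4) (𝓡 4) ∞ e₁)
      (_he₂ : Manifold.IsSmoothEmbedding (𝓡∂ 4) (𝓡 4) ∞ e₂)
      (_hcover : range e₁ ∪ range e₂ = univ)
      (_hseam₁ : range e₁ ∩ range e₂ = e₁ '' (𝓡∂ 4).boundary W₁)
      (_hseam₂ : range e₁ ∩ range e₂ = e₂ '' (𝓡∂ 4).boundary W₂)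
      (_hξ : ∀ w₁ w₂, e₁ w₁ = e₂ w₂ →
        Submodule.map (mfderiv (𝓡∂ 4) (𝓡 4) e₁ w₁).toLinearMap (contactPlane J₁.J w₁) =
        Submodule.map (mfderiv (𝓡∂ 4) (𝓡 4) e₂ w₂).toLinearMap (contactPlane J₂.J w₂))
      (_hac : ∀ k, 0 < k → IsZero (singularHomology ℚ ℚ W₁ k) ∧ IsZero (singularHomology ℚ ℚ W₂ k))
      (f₂ : W₂ → ℝ) (_hf₂ : IsMorseAdapted (𝓡∂ 4) f₂)
      (_hf₂i : ∀ z, IsMCriticalPt (𝓡∂ 4) f₂ z → morseIndex (𝓡∂ 4) f₂ z ≤ 2)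
      (_hf₂0 : (criticalSetOfIndex (𝓡∂ 4) f₂ 0).ncard = 1)
      (_hf₂b : (criticalSetOfIndex (𝓡∂ 4) f₂ 1).ncard = (criticalSetOfIndex (𝓡∂ 4) f₂ 2).ncard)
      (_hnd : ¬ ∃ Φ : W₁ ≃ₘ⟮𝓡∂ 4, 𝓡∂ 4⟯ W₂, ∀ w, w ∈ (𝓡∂ 4).boundary W₁ → e₂ (Φ w) = e₁ w),
      ∃ F : M → ℝ, IsMorse (𝓡 4) F ∧ criticalSetOfIndex (𝓡 4) F 1 = ∅ ∧
        (criticalSetOfIndex (𝓡 4) F 2).ncard = (criticalSetOfIndex (𝓡∂ 4) f₂ 1).ncard)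
    (M : Type) [TopologicalSpace M] [T2Space M] [SecondCountableTopology M] [ChartedSpace (EuclideanSpace ℝ (Fin 4)) M]
    [IsManifold (𝓡 4) ∞ M] (hM : M ≃ₕ Metric.sphere (0 : EuclideanSpace ℝ (Fin 5)) 1)
    (W₁ : Type) [TopologicalSpace W₁] [ChartedSpace (EuclideanHalfSpace 4) W₁] [IsManifold (𝓡∂ 4) ∞ W₁]
    [CompactSpace W₁] (W₂ : Type) [TopologicalSpace W₂] [ChartedSpace (EuclideanHalfSpace 4) W₂]
    [IsManifold (𝓡∂ 4) ∞ W₂] [CompactSpace W₂] (J₁ : SteinStructure W₁) (J₂ : SteinStructure W₂)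
    (e₁ : W₁ → M) (e₂ : W₂ → M)
    (he₁ : Manifold.IsSmoothEmbedding (𝓡∂ 4) (𝓡 4) ∞ e₁)
    (he₂ : Manifold.IsSmoothEmbedding (𝓡∂ 4) (𝓡 4) ∞ e₂)
    (hcover : range e₁ ∪ range e₂ = univ)
    (hseam₁ : range e₁ ∩ range e₂ = e₁ '' (𝓡∂ 4).boundary W₁)
    (hseam₂ : range e₁ ∩ range e₂ = e₂ '' (𝓡∂ 4).boundary W₂)
    (hξ : ∀ w₁ w₂, e₁ w₁ = e₂ w₂ →
      Submodule.map (mfderiv (𝓡∂ 4) (𝓡 4) e₁ w₁).toLinearMap (contactPlane J₁.J w₁) =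
      Submodule.map (mfderiv (𝓡∂ 4) (𝓡 4) e₂ w₂).toLinearMap (contactPlane J₂.J w₂))
    (hac : ∀ k, 0 < k → IsZero (singularHomology ℚ ℚ W₁ k) ∧ IsZero (singularHomology ℚ ℚ W₂ k))
    (hnd : ¬ ∃ Φ : W₁ ≃ₘ⟮𝓡∂ 4, 𝓡∂ 4⟯ W₂, ∀ w, w ∈ (𝓡∂ 4).boundary W₁ → e₂ (Φ w) = e₁ w) :
    ∃ F : M → ℝ, IsMorse (𝓡 4) F ∧ criticalSetOfIndex (𝓡 4) F 1 = ∅ := by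
  -- the crux data is symmetric in the two halves: a balanced Stein normal form of `W₂`
  have hcover' : range e₂ ∪ range e₁ = univ := by rw [union_comm]; exact hcover
  have hseam₁' : range e₂ ∩ range e₁ = e₂ '' (𝓡∂ 4).boundary W₂ := by rw [inter_comm]; exact hseam₂
  have hseam₂' : range e₂ ∩ range e₁ = e₁ '' (𝓡∂ 4).boundary W₁ := by rw [inter_comm]; exact hseam₁
  have hξ' : ∀ w₂ w₁, e₂ w₂ = e₁ w₁ →
      Submodule.map (mfderiv (𝓡∂ 4) (𝓡 4) e₂ w₂).toLinearMap (contactPlane J₂.J w₂) =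
      Submodule.map (mfderiv (𝓡∂ 4) (𝓡 4) e₁ w₁).toLinearMap (contactPlane J₁.J w₁) :=
    fun w₂ w₁ h => (hξ w₁ w₂ h.symm).symm
  have hac' : ∀ k, 0 < k → IsZero (singularHomology ℚ ℚ W₂ k) ∧ IsZero (singularHomology ℚ ℚ W₁ k) :=
    fun k hk => ⟨(hac k hk).2, (hac k hk).1⟩
  obtain ⟨f₂, hf₂, hf₂i, hf₂0, hf₂b⟩ :=
    stub_steinHandleNormalForm stub_factGompf M hM W₂ W₁ J₂ J₁ e₂ e₁ he₂ he₁ hcover' hseam₁' hseam₂' hξ' hac'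
  obtain ⟨F, hF, h1, -⟩ := hL M hM W₁ W₂ J₁ J₂ e₁ e₂ he₁ he₂ hcover hseam₁ hseam₂ hξ hac f₂ hf₂ hf₂i hf₂0
    hf₂b hnd
  exact ⟨F, hF, h1⟩

/-- **The GSC lever is implied by the crux** (it is the crux restricted to its sector, read through a Morse function of `S⁴`): given
`M ≅ S⁴`, pull back the tree's Morse function on the round sphere with profile `(1, 0, 1, 1, 1)` (`exists_isMorse_sphereFour_twoThree`,
Milnor's height function with one birth) along the diffeomorphism (`SeamGluing.IsMorse.comp_diffeomorph`,
`SeamGluing.criticalSetOfIndex_comp_diffeomorph`, lead c1). Hence the stub is SPC4-shielded (`gscOfNonDouble_of_spc4`): refutable only by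
an exotic 4-sphere — CERTIFIED here, where for lever B verbatim (prescribed 2-handle count `n₂`) the same certificate would need births
of `n₂` cancelling `2/3` pairs on `S⁴`, not in the tree. Honest labelling for the planner: the statement to PROMOTE is this one.
[folklore] -/
theorem gscOfNonDouble_of_crux (h : ConvexBisection.AcyclicBisectionRigidity)
    (M : Type) [TopologicalSpace M] [T2Space M] [SecondCountableTopology M] [ChartedSpace (EuclideanSpace ℝ (Fin 4)) M]
    [IsManifold (𝓡 4) ∞ M] (hM : M ≃ₕ Metric.sphere (0 : EuclideanSpace ℝ (Fin 5)) 1)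
    (W₁ : Type) [TopologicalSpace W₁] [ChartedSpace (EuclideanHalfSpace 4) W₁] [IsManifold (𝓡∂ 4) ∞ W₁]
    [CompactSpace W₁] (W₂ : Type) [TopologicalSpace W₂] [ChartedSpace (EuclideanHalfSpace 4) W₂]
    [IsManifold (𝓡∂ 4) ∞ W₂] [CompactSpace W₂] (J₁ : SteinStructure W₁) (J₂ : SteinStructure W₂)
    (e₁ : W₁ → M) (e₂ : W₂ → M)
    (he₁ : Manifold.IsSmoothEmbedding (𝓡∂ 4) (𝓡 4) ∞ e₁)
    (he₂ : Manifold.IsSmoothEmbedding (𝓡∂ 4) (𝓡 4) ∞ e₂)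
    (hcover : range e₁ ∪ range e₂ = univ)
    (hseam₁ : range e₁ ∩ range e₂ = e₁ '' (𝓡∂ 4).boundary W₁)
    (hseam₂ : range e₁ ∩ range e₂ = e₂ '' (𝓡∂ 4).boundary W₂)
    (hξ : ∀ w₁ w₂, e₁ w₁ = e₂ w₂ →
      Submodule.map (mfderiv (𝓡∂ 4) (𝓡 4) e₁ w₁).toLinearMap (contactPlane J₁.J w₁) =
      Submodule.map (mfderiv (𝓡∂ 4) (𝓡 4) e₂ w₂).toLinearMap (contactPlane J₂.J w₂))
    (hac : ∀ k, 0 < k → IsZero (singularHomology ℚ ℚ W₁ k) ∧ IsZero (singularHomology ℚ ℚ W₂ k))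
    (_hnd : ¬ ∃ Φ : W₁ ≃ₘ⟮𝓡∂ 4, 𝓡∂ 4⟯ W₂, ∀ w, w ∈ (𝓡∂ 4).boundary W₁ → e₂ (Φ w) = e₁ w) :
    ∃ F : M → ℝ, IsMorse (𝓡 4) F ∧ criticalSetOfIndex (𝓡 4) F 1 = ∅ := by
  obtain ⟨Φ⟩ := h M hM ⟨W₁, _, _, _, _, W₂, _, _, _, _, J₁, J₂, e₁, e₂, he₁, he₂, hcover, hseam₁, hseam₂, hξ, hac⟩
  obtain ⟨f, -, hf, hfin, -, hf1, -⟩ := exists_isMorse_sphereFour_twoThree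
  refine ⟨f ∘ Φ, IsMorse.comp_diffeomorph Φ hf, ?_⟩
  rw [criticalSetOfIndex_comp_diffeomorph Φ hf.contMDiff 1]
  have hfin1 : (criticalSetOfIndex (𝓡 4) f 1).Finite := hfin.subset (criticalSetOfIndex_subset _ f 1)
  rw [(Set.ncard_eq_zero hfin1).1 hf1, Set.preimage_empty]

/-- **Hence the GSC lever is SPC4-shielded**: `SmoothPoincare4` implies it (Disproof §1 `shielded_of_spc4`, here through
`gscOfNonDouble_of_crux` and the landed `Negative.not_smoothPoincare4_of_not_crux`). [folklore] -/
theorem gscOfNonDouble_of_spc4 (h : SmoothPoincare4)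
    (M : Type) [TopologicalSpace M] [T2Space M] [SecondCountableTopology M] [ChartedSpace (EuclideanSpace ℝ (Fin 4)) M]
    [IsManifold (𝓡 4) ∞ M] (hM : M ≃ₕ Metric.sphere (0 : EuclideanSpace ℝ (Fin 5)) 1)
    (W₁ : Type) [TopologicalSpace W₁] [ChartedSpace (EuclideanHalfSpace 4) W₁] [IsManifold (𝓡∂ 4) ∞ W₁]
    [CompactSpace W₁] (W₂ : Type) [TopologicalSpace W₂] [ChartedSpace (EuclideanHalfSpace 4) W₂]
    [IsManifold (𝓡∂ 4) ∞ W₂] [CompactSpace W₂] (J₁ : SteinStructure W₁) (J₂ : SteinStructure W₂)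
    (e₁ : W₁ → M) (e₂ : W₂ → M)
    (he₁ : Manifold.IsSmoothEmbedding (𝓡∂ 4) (𝓡 4) ∞ e₁)
    (he₂ : Manifold.IsSmoothEmbedding (𝓡∂ 4) (𝓡 4) ∞ e₂)
    (hcover : range e₁ ∪ range e₂ = univ)
    (hseam₁ : range e₁ ∩ range e₂ = e₁ '' (𝓡∂ 4).boundary W₁)
    (hseam₂ : range e₁ ∩ range e₂ = e₂ '' (𝓡∂ 4).boundary W₂)
    (hξ : ∀ w₁ w₂, e₁ w₁ = e₂ w₂ →
      Submodule.map (mfderiv (𝓡∂ 4) (𝓡 4) e₁ w₁).toLinearMap (contactPlane J₁.J w₁) =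
      Submodule.map (mfderiv (𝓡∂ 4) (𝓡 4) e₂ w₂).toLinearMap (contactPlane J₂.J w₂))
    (hac : ∀ k, 0 < k → IsZero (singularHomology ℚ ℚ W₁ k) ∧ IsZero (singularHomology ℚ ℚ W₂ k))
    (hnd : ¬ ∃ Φ : W₁ ≃ₘ⟮𝓡∂ 4, 𝓡∂ 4⟯ W₂, ∀ w, w ∈ (𝓡∂ 4).boundary W₁ → e₂ (Φ w) = e₁ w) :
    ∃ F : M → ℝ, IsMorse (𝓡 4) F ∧ criticalSetOfIndex (𝓡 4) F 1 = ∅ := by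
  have hcrux : ConvexBisection.AcyclicBisectionRigidity := by
    by_contra hn
    exact Summit.SmoothPoincare4.SmoothPoincare4.Theorems.AcyclicBisectionRigidity.Negative.not_smoothPoincare4_of_not_crux hn h
  exact gscOfNonDouble_of_crux hcrux M hM W₁ W₂ J₁ J₂ e₁ e₂ he₁ he₂ hcover hseam₁ hseam₂ hξ hac hnd


/-- **Lever A is implied by the crux as well** (hence SPC4-shielded, `seamPairDichotomy_of_spc4`): given `M ≅ S⁴`, the pulled-back
`exists_isMorse_sphereFour_twoThree` has profile exactly `(1, 0, 1, 1, 1)` (`SeamGluing.ncard_criticalSetOfIndex_comp_diffeomorph`), which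
is the first horn. Certified here for the record: of the three conjectural statements of the round-2 seam lines only lever B VERBATIM
(prescribed count `n₂`) lacks this certificate in the tree (births of cancelling pairs). [folklore] -/
theorem seamPairDichotomy_of_crux (h : ConvexBisection.AcyclicBisectionRigidity)
    (M : Type) [TopologicalSpace M] [T2Space M] [SecondCountableTopology M] [ChartedSpace (EuclideanSpace ℝ (Fin 4)) M]
    [IsManifold (𝓡 4) ∞ M] (hM : M ≃ₕ Metric.sphere (0 : EuclideanSpace ℝ (Fin 5)) 1)
    (W₁ : Type) [TopologicalSpace W₁] [ChartedSpace (EuclideanHalfSpace 4) W₁] [IsManifold (𝓡∂ 4) ∞ W₁]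
    [CompactSpace W₁] (W₂ : Type) [TopologicalSpace W₂] [ChartedSpace (EuclideanHalfSpace 4) W₂]
    [IsManifold (𝓡∂ 4) ∞ W₂] [CompactSpace W₂] (J₁ : SteinStructure W₁) (J₂ : SteinStructure W₂)
    (e₁ : W₁ → M) (e₂ : W₂ → M)
    (he₁ : Manifold.IsSmoothEmbedding (𝓡∂ 4) (𝓡 4) ∞ e₁)
    (he₂ : Manifold.IsSmoothEmbedding (𝓡∂ 4) (𝓡 4) ∞ e₂)
    (hcover : range e₁ ∪ range e₂ = univ)
    (hseam₁ : range e₁ ∩ range e₂ = e₁ '' (𝓡∂ 4).boundary W₁)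
    (hseam₂ : range e₁ ∩ range e₂ = e₂ '' (𝓡∂ 4).boundary W₂)
    (hξ : ∀ w₁ w₂, e₁ w₁ = e₂ w₂ →
      Submodule.map (mfderiv (𝓡∂ 4) (𝓡 4) e₁ w₁).toLinearMap (contactPlane J₁.J w₁) =
      Submodule.map (mfderiv (𝓡∂ 4) (𝓡 4) e₂ w₂).toLinearMap (contactPlane J₂.J w₂))
    (hac : ∀ k, 0 < k → IsZero (singularHomology ℚ ℚ W₁ k) ∧ IsZero (singularHomology ℚ ℚ W₂ k))
    (_h₁ : HasHandleDecomposition 3 W₁ (fun k => if k ≤ 2 then 1 else 0))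
    (_h₂ : HasHandleDecomposition 3 W₂ (fun k => if k ≤ 2 then 1 else 0))
    (_hB : ¬ (HasHandleDecomposition 3 W₁ (fun k => if k = 0 then 1 else 0) ∨
      HasHandleDecomposition 3 W₂ (fun k => if k = 0 then 1 else 0))) :
    (∃ F : M → ℝ, IsMorse (𝓡 4) F ∧ (criticalSetOfIndex (𝓡 4) F 0).ncard = 1 ∧
        criticalSetOfIndex (𝓡 4) F 1 = ∅ ∧ (criticalSetOfIndex (𝓡 4) F 2).ncard = 1 ∧
        (criticalSetOfIndex (𝓡 4) F 3).ncard = 1 ∧ (criticalSetOfIndex (𝓡 4) F 4).ncard = 1) ∨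
      ∃ b : BoundaryData (𝓡∂ 4) W₁ (𝓡 3), IsDouble b (𝓡 4) M := by
  left
  obtain ⟨Φ⟩ := h M hM ⟨W₁, _, _, _, _, W₂, _, _, _, _, J₁, J₂, e₁, e₂, he₁, he₂, hcover, hseam₁, hseam₂, hξ, hac⟩
  obtain ⟨f, -, hf, hfin, hf0, hf1, hf2, hf3, hf4, -⟩ := exists_isMorse_sphereFour_twoThree
  have hn := fun k => ncard_criticalSetOfIndex_comp_diffeomorph Φ hf.contMDiff k
  refine ⟨f ∘ Φ, IsMorse.comp_diffeomorph Φ hf, by rw [hn 0, hf0], ?_, by rw [hn 2, hf2], by rw [hn 3, hf3],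
    by rw [hn 4, hf4]⟩
  rw [criticalSetOfIndex_comp_diffeomorph Φ hf.contMDiff 1]
  have hfin1 : (criticalSetOfIndex (𝓡 4) f 1).Finite := hfin.subset (criticalSetOfIndex_subset _ f 1)
  rw [(Set.ncard_eq_zero hfin1).1 hf1, Set.preimage_empty]

/-- **Hence lever A is SPC4-shielded** (certified). [folklore] -/
theorem seamPairDichotomy_of_spc4 (h : SmoothPoincare4)
    (M : Type) [TopologicalSpace M] [T2Space M] [SecondCountableTopology M] [ChartedSpace (EuclideanSpace ℝ (Fin 4)) M]
    [IsManifold (𝓡 4) ∞ M] (hM : M ≃ₕ Metric.sphere (0 : EuclideanSpace ℝ (Fin 5)) 1)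
    (W₁ : Type) [TopologicalSpace W₁] [ChartedSpace (EuclideanHalfSpace 4) W₁] [IsManifold (𝓡∂ 4) ∞ W₁]
    [CompactSpace W₁] (W₂ : Type) [TopologicalSpace W₂] [ChartedSpace (EuclideanHalfSpace 4) W₂]
    [IsManifold (𝓡∂ 4) ∞ W₂] [CompactSpace W₂] (J₁ : SteinStructure W₁) (J₂ : SteinStructure W₂)
    (e₁ : W₁ → M) (e₂ : W₂ → M)
    (he₁ : Manifold.IsSmoothEmbedding (𝓡∂ 4) (𝓡 4) ∞ e₁)
    (he₂ : Manifold.IsSmoothEmbedding (𝓡∂ 4) (𝓡 4) ∞ e₂)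
    (hcover : range e₁ ∪ range e₂ = univ)
    (hseam₁ : range e₁ ∩ range e₂ = e₁ '' (𝓡∂ 4).boundary W₁)
    (hseam₂ : range e₁ ∩ range e₂ = e₂ '' (𝓡∂ 4).boundary W₂)
    (hξ : ∀ w₁ w₂, e₁ w₁ = e₂ w₂ →
      Submodule.map (mfderiv (𝓡∂ 4) (𝓡 4) e₁ w₁).toLinearMap (contactPlane J₁.J w₁) =
      Submodule.map (mfderiv (𝓡∂ 4) (𝓡 4) e₂ w₂).toLinearMap (contactPlane J₂.J w₂))
    (hac : ∀ k, 0 < k → IsZero (singularHomology ℚ ℚ W₁ k) ∧ IsZero (singularHomology ℚ ℚ W₂ k))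
    (h₁ : HasHandleDecomposition 3 W₁ (fun k => if k ≤ 2 then 1 else 0))
    (h₂ : HasHandleDecomposition 3 W₂ (fun k => if k ≤ 2 then 1 else 0))
    (hB : ¬ (HasHandleDecomposition 3 W₁ (fun k => if k = 0 then 1 else 0) ∨
      HasHandleDecomposition 3 W₂ (fun k => if k = 0 then 1 else 0))) :
    (∃ F : M → ℝ, IsMorse (𝓡 4) F ∧ (criticalSetOfIndex (𝓡 4) F 0).ncard = 1 ∧
        criticalSetOfIndex (𝓡 4) F 1 = ∅ ∧ (criticalSetOfIndex (𝓡 4) F 2).ncard = 1 ∧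
        (criticalSetOfIndex (𝓡 4) F 3).ncard = 1 ∧ (criticalSetOfIndex (𝓡 4) F 4).ncard = 1) ∨
      ∃ b : BoundaryData (𝓡∂ 4) W₁ (𝓡 3), IsDouble b (𝓡 4) M := by
  have hcrux : ConvexBisection.AcyclicBisectionRigidity := by
    by_contra hn
    exact Summit.SmoothPoincare4.SmoothPoincare4.Theorems.AcyclicBisectionRigidity.Negative.not_smoothPoincare4_of_not_crux hn h
  exact seamPairDichotomy_of_crux hcrux M hM W₁ W₂ J₁ J₂ e₁ e₂ he₁ he₂ hcover hseam₁ hseam₂ hξ hac h₁ h₂ hB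

end Summit.SmoothPoincare4.SmoothPoincare4.Theorems.AcyclicBisectionRigidity.SeamDualityCancellation

end
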